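import Summits.Ventures.HodgeRepro2.T5SU11JacobiIntegerCrossCheck

/-!
# The integer-weight transforms at integer parameters: `m̂_{2j}(λ) sin(πλ/2) = R_j(λ)` on the whole
strip, and `m̂_{2j+1}(2n) = (−1)^n Q_j(2n)`, `m̂_{2j}(2n+1) = (−1)^n R_j(2n+1)`

The even-weight companion of `T5SU11JacobiIntegerWeight.integral_orbit_rpow_odd_mul_sph_mul_cos`:
**`m̂_{2j}(λ) · sin(πλ/2) = R_j(λ)` for every `2 − 2j < λ < 2j`** (`integral_orbit_rpow_even_mul_sph_mul_sin`;
at a zero `λ = 2n` of the sine a Pochhammer factor of `R_j` vanishes). Consequently the transforms of the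
integer-weight coefficient moduli at integer parameters of the opposite parity are explicit signed
rationals times `π` (odd weights) or `π²` (even weights): **`m̂_{2j+1}(2n) = (−1)^n Q_j(2n)`** for
`0 ≤ n ≤ j` (`integral_orbit_rpow_odd_mul_sph_even_nat`) and **`m̂_{2j}(2n+1) = (−1)^n R_j(2n+1)`** for
`0 ≤ n < j` (`integral_orbit_rpow_even_mul_sph_odd_nat`). Cross-checks at `λ = 2` (`φ_2 ≡ 1`):
`m̂_5(2) = 2π/3` and `m̂_7(2) = 2π/5` both from the signed formula and from the `L¹`-norms
(`integral_orbit_rpow_five_mul_sph_two`, `…'`, `integral_orbit_rpow_seven_mul_sph_two`, `…'`);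
`m̂_6(3) = 15π²/64` (`integral_orbit_rpow_six_mul_sph_three`). Nothing is claimed about (N).

Blind lane: Mathlib + the HodgeRepro2 prefix only; no sorry; axioms ⊆ {propext, Classical.choice,
Quot.sound}.
-/

namespace Summit.Ventures.HodgeRepro2.T5SU11JacobiIntegerValues

open MeasureTheory MeasureTheory.Measure Metric Set Filter Topology
open T5SU11Unimodular T5SU11Fibration T5SU11Cartan T5HaarCircle T5BergmanCoefficient
  T5SU11FibrationHaar T5SU11SphericalFunction T5SU11SphericalSymmetry T5SU11SphericalTwo
  T5SU11JacobiIwasawa T5SU11JacobiTransform T5SU11XiTransform T5SU11JacobiThreeFour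
  T5SU11AbelConstInteger T5SU11JacobiIntegerWeight T5SU11JacobiIntegerCrossCheck
open scoped Real Nat

/-- `cos(π(2n)/2) = (−1)^n` for natural `n`. -/
lemma cos_pi_mul_two_nat_div_two (n : ℕ) : Real.cos (π * (2 * n) / 2) = (-1) ^ n := by
  rw [show π * (2 * n) / 2 = n * π by ring, Real.cos_nat_mul_pi]

/-- `sin(π(2n+1)/2) = (−1)^n` for natural `n`. -/
lemma sin_pi_mul_odd_nat_div_two (n : ℕ) : Real.sin (π * (2 * n + 1) / 2) = (-1) ^ n := by
  rw [show π * (2 * n + 1) / 2 = n * π + π / 2 by ring, Real.sin_add_pi_div_two, Real.cos_nat_mul_pi]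

section measure

variable [MeasurableSpace Circle] [BorelSpace Circle]

/-! ### The even multiplied form -/

/-- **The multiplied form for even weights on the whole strip**: `m̂_{2j}(λ) sin(πλ/2) = R_j(λ)` for every
`2 − 2j < λ < 2j` — at a zero `λ = 2n` of the sine the factor `i = n − 1` (`n ≥ 1`) of the first product
or `i = −n` (`n ≤ 0`) of the second vanishes. -/
theorem integral_orbit_rpow_even_mul_sph_mul_sin (j : ℕ) (hj : 2 ≤ j) {lam : ℝ}
    (h1 : 2 - 2 * (j : ℝ) < lam) (h2 : lam < 2 * j) :
    (∫ g, (1 - ‖orbit g‖ ^ 2) ^ (((2 * j : ℕ) : ℝ) / 2) * sph lam g ∂(nu haarCircle))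
        * Real.sin (π * lam / 2)
      = 2 ^ (2 * j - 2) * (π * ((2 * j - 2)! : ℝ) / (4 ^ (j - 1) * ((j - 1)! : ℝ) ^ 2))
          / ((2 * j - 2)! : ℝ)
        * (π * (∏ i ∈ Finset.range (j - 1), (1 - lam / 2 + i))
          * (∏ i ∈ Finset.range (j - 1), (lam / 2 + i))) := by
  by_cases hs : Real.sin (π * lam / 2) = 0
  · rw [hs, mul_zero]
    obtain ⟨n, hn⟩ := Real.sin_eq_zero_iff.mp hs
    have hlam : lam = 2 * n := by
      have hπ : π ≠ 0 := Real.pi_pos.ne'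
      have : π * lam = π * (2 * n) := by linarith
      exact mul_left_cancel₀ hπ this
    rcases le_or_gt 1 n with hn1 | hn1
    · -- `λ = 2n`, `n ≥ 1`: the factor `i = n − 1` of the first product vanishes
      obtain ⟨i, hi'⟩ : ∃ i : ℕ, (i : ℤ) = n - 1 := ⟨(n - 1).toNat, Int.toNat_of_nonneg (by omega)⟩
      have hiR : (i : ℝ) = (n : ℝ) - 1 := by exact_mod_cast congrArg (fun z : ℤ => (z : ℝ)) hi'
      have hi : i < j - 1 := by
        have : (i : ℝ) + 1 < j := by rw [hiR]; linarith
        have : i + 1 < j := by exact_mod_cast this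
        omega
      have hz : 1 - lam / 2 + (i : ℝ) = 0 := by rw [hiR, hlam]; ring
      rw [Finset.prod_eq_zero (Finset.mem_range.mpr hi) hz]
      ring
    · -- `λ = 2n`, `n ≤ 0`: the factor `i = −n` of the second product vanishes
      obtain ⟨i, hi'⟩ : ∃ i : ℕ, (i : ℤ) = -n := ⟨(-n).toNat, Int.toNat_of_nonneg (by omega)⟩
      have hiR : (i : ℝ) = -(n : ℝ) := by exact_mod_cast congrArg (fun z : ℤ => (z : ℝ)) hi'
      have hi : i < j - 1 := by
        have : (i : ℝ) + 1 < j := by rw [hiR]; linarith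
        have : i + 1 < j := by exact_mod_cast this
        omega
      have hz : lam / 2 + (i : ℝ) = 0 := by rw [hiR, hlam]; ring
      rw [Finset.prod_eq_zero (f := fun i : ℕ => lam / 2 + (i : ℝ)) (Finset.mem_range.mpr hi) hz]
      ring
  · rw [integral_orbit_rpow_even_mul_sph j hj h1 h2 hs, div_mul_cancel₀ _ hs]

/-! ### Integer parameters of the opposite parity -/

/-- **Odd weights at even parameters**: `m̂_{2j+1}(2n) = (−1)^n Q_j(2n)` for `0 ≤ n ≤ j` — a signed
rational multiple of `π`. -/
theorem integral_orbit_rpow_odd_mul_sph_even_nat (j n : ℕ) (hj : 1 ≤ j) (hn : n ≤ j) :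
    ∫ g, (1 - ‖orbit g‖ ^ 2) ^ (((2 * j + 1 : ℕ) : ℝ) / 2) * sph (2 * n) g ∂(nu haarCircle)
      = (-1) ^ n * (2 ^ (2 * j - 1) * (4 ^ j * (j ! : ℝ) * ((j - 1)! : ℝ) / ((2 * j)! : ℝ))
          / ((2 * j - 1)! : ℝ)
        * (π * (∏ i ∈ Finset.range j, ((1 - 2 * (n : ℝ)) / 2 + i))
          * (∏ i ∈ Finset.range (j - 1), ((1 + 2 * (n : ℝ)) / 2 + i)))) := by
  have hj' : (1 : ℝ) ≤ j := by exact_mod_cast hj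
  have hn' : (n : ℝ) ≤ j := by exact_mod_cast hn
  have h := integral_orbit_rpow_odd_mul_sph_mul_cos j hj (lam := 2 * n) (by linarith) (by linarith)
  rw [cos_pi_mul_two_nat_div_two] at h
  have hpm : ((-1 : ℝ) ^ n) * ((-1 : ℝ) ^ n) = 1 := by
    rw [← pow_add, ← two_mul, pow_mul]; simp
  calc ∫ g, (1 - ‖orbit g‖ ^ 2) ^ (((2 * j + 1 : ℕ) : ℝ) / 2) * sph (2 * n) g ∂(nu haarCircle)
      = (∫ g, (1 - ‖orbit g‖ ^ 2) ^ (((2 * j + 1 : ℕ) : ℝ) / 2) * sph (2 * n) g ∂(nu haarCircle))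
          * ((-1 : ℝ) ^ n * (-1 : ℝ) ^ n) := by rw [hpm, mul_one]
    _ = (-1) ^ n * ((∫ g, (1 - ‖orbit g‖ ^ 2) ^ (((2 * j + 1 : ℕ) : ℝ) / 2) * sph (2 * n) g
          ∂(nu haarCircle)) * (-1) ^ n) := by ring
    _ = _ := by rw [h]

/-- **Even weights at odd parameters**: `m̂_{2j}(2n+1) = (−1)^n R_j(2n+1)` for `0 ≤ n < j` — a signed
rational multiple of `π²`. -/
theorem integral_orbit_rpow_even_mul_sph_odd_nat (j n : ℕ) (hj : 2 ≤ j) (hn : n < j) :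
    ∫ g, (1 - ‖orbit g‖ ^ 2) ^ (((2 * j : ℕ) : ℝ) / 2) * sph (2 * n + 1) g ∂(nu haarCircle)
      = (-1) ^ n * (2 ^ (2 * j - 2) * (π * ((2 * j - 2)! : ℝ) / (4 ^ (j - 1) * ((j - 1)! : ℝ) ^ 2))
          / ((2 * j - 2)! : ℝ)
        * (π * (∏ i ∈ Finset.range (j - 1), (1 - (2 * (n : ℝ) + 1) / 2 + i))
          * (∏ i ∈ Finset.range (j - 1), ((2 * (n : ℝ) + 1) / 2 + i)))) := by
  have hj' : (2 : ℝ) ≤ j := by exact_mod_cast hj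
  have hn' : (n : ℝ) + 1 ≤ j := by exact_mod_cast hn
  have h := integral_orbit_rpow_even_mul_sph_mul_sin j hj (lam := 2 * n + 1) (by linarith) (by linarith)
  rw [sin_pi_mul_odd_nat_div_two] at h
  have hpm : ((-1 : ℝ) ^ n) * ((-1 : ℝ) ^ n) = 1 := by
    rw [← pow_add, ← two_mul, pow_mul]; simp
  calc ∫ g, (1 - ‖orbit g‖ ^ 2) ^ (((2 * j : ℕ) : ℝ) / 2) * sph (2 * n + 1) g ∂(nu haarCircle)
      = (∫ g, (1 - ‖orbit g‖ ^ 2) ^ (((2 * j : ℕ) : ℝ) / 2) * sph (2 * n + 1) g ∂(nu haarCircle))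
          * ((-1 : ℝ) ^ n * (-1 : ℝ) ^ n) := by rw [hpm, mul_one]
    _ = (-1) ^ n * ((∫ g, (1 - ‖orbit g‖ ^ 2) ^ (((2 * j : ℕ) : ℝ) / 2) * sph (2 * n + 1) g
          ∂(nu haarCircle)) * (-1) ^ n) := by ring
    _ = _ := by rw [h]

/-! ### Cross-checks at `λ = 2` (`φ_2 ≡ 1`) and the value `m̂_6(3)` -/

/-- **Weight 5 at `λ = 2`, signed formula**: `m̂_5(2) = −Q_2(2) = 2π/3`. -/
theorem integral_orbit_rpow_five_mul_sph_two :
    ∫ g, (1 - ‖orbit g‖ ^ 2) ^ ((5 : ℝ) / 2) * sph 2 g ∂(nu haarCircle) = 2 * π / 3 := by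
  have h := integral_orbit_rpow_odd_mul_sph_even_nat 2 1 (by norm_num) (by norm_num)
  simp only [Finset.prod_range_succ, Finset.prod_range_zero, Nat.cast_zero, Nat.cast_one,
    add_zero] at h
  rw [show ((2 * 2 + 1 : ℕ) : ℝ) = 5 by norm_num, mul_one] at h
  rw [h]
  norm_num [Nat.factorial]
  ring

/-- **Weight 5 at `λ = 2`, `L¹`-norm**: the same `2π/3` (`φ_2 ≡ 1`, `integral_orbit_rpow_nu`). -/
theorem integral_orbit_rpow_five_mul_sph_two' :
    ∫ g, (1 - ‖orbit g‖ ^ 2) ^ ((5 : ℝ) / 2) * sph 2 g ∂(nu haarCircle) = 2 * π / 3 := by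
  simp only [sph_two, mul_one]
  exact integral_orbit_rpow_five

/-- **Weight 7 at `λ = 2`, signed formula**: `m̂_7(2) = −Q_3(2) = 2π/5`. -/
theorem integral_orbit_rpow_seven_mul_sph_two :
    ∫ g, (1 - ‖orbit g‖ ^ 2) ^ ((7 : ℝ) / 2) * sph 2 g ∂(nu haarCircle) = 2 * π / 5 := by
  have h := integral_orbit_rpow_odd_mul_sph_even_nat 3 1 (by norm_num) (by norm_num)
  simp only [Finset.prod_range_succ, Finset.prod_range_zero, Nat.cast_zero, Nat.cast_one,
    add_zero] at h
  rw [show ((2 * 3 + 1 : ℕ) : ℝ) = 7 by norm_num, mul_one] at h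
  rw [h]
  norm_num [Nat.factorial]
  ring

/-- **Weight 7 at `λ = 2`, `L¹`-norm**: the same `2π/5`. -/
theorem integral_orbit_rpow_seven_mul_sph_two' :
    ∫ g, (1 - ‖orbit g‖ ^ 2) ^ ((7 : ℝ) / 2) * sph 2 g ∂(nu haarCircle) = 2 * π / 5 := by
  simp only [sph_two, mul_one]
  exact integral_orbit_rpow_seven

/-- **Weight 6 at `λ = 3`**: `m̂_6(3) = −R_3(3) = 15π²/64`. -/
theorem integral_orbit_rpow_six_mul_sph_three :
    ∫ g, (1 - ‖orbit g‖ ^ 2) ^ ((6 : ℝ) / 2) * sph 3 g ∂(nu haarCircle) = 15 * π ^ 2 / 64 := by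
  have h := integral_orbit_rpow_even_mul_sph_odd_nat 3 1 (by norm_num) (by norm_num)
  simp only [Finset.prod_range_succ, Finset.prod_range_zero, Nat.cast_zero, Nat.cast_one,
    add_zero] at h
  rw [show ((2 * 3 : ℕ) : ℝ) = 6 by norm_num, mul_one, show (2 : ℝ) + 1 = 3 by norm_num] at h
  rw [h]
  norm_num [Nat.factorial]
  ring

end measure

end Summit.Ventures.HodgeRepro2.T5SU11JacobiIntegerValues
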